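import Mathlib
import Summits.Ventures.PercRepro2.ThreeTermPatternCone

/-!
# The Harris cone of the five partitions pulls back to the Harris cone of any pattern world
(blind cell PercRepro2, night-3 g29, 2026-08-29; `proofs/NIGHT3-CERT.md` §38)

g28's certificates (`ThreeTermHarrisCone.lean`, certlp.py) live on the FIVE partitions of three terminals:
`ThreeTerm.InCone N` says the cubic `N` on laws `Fin 5 → ℚ` is a nonnegative combination of the `125`
monomials and the `45` Harris generators `μ p · hslack s μ`.  The part theorem
(`Part.typedCount_part_nonneg`, ThreeTermPartLaw.lean) asks for membership in the cone `InConeP π` of the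
EIGHT-pattern world.  **`inConeP_of_inCone`**: a cubic in the five-world cone, pulled back along the
push-forward `pushfP π`, lies in the eight-world cone — every five-world monomial is a sum of
eight-world monomials over the fibres of `π`, every five-world generator `hgen p s` is the sum of the
eight-world generators `genP π a s` over the fibre of `p` (`hgen_pushfP`).  **`cubicOf_eq_pushfP`**: a
coefficient array constant on the fibres of `π` (`T i j k = T₅ (π i) (π j) (π k)`) has `cubicOf T` equal
to the pulled-back five-world cubic — so a certificate on the `5³` partition table certifies the `8³`
pattern table (`inConeP_cubicOf_of_inCone`).  Own work; standard axioms.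
-/

namespace Summit.Ventures.PercRepro2

open ThreeTerm TypedStar

namespace Part

section Transfer

variable (π : Fin 8 → Fin 5)

/-- A five-world monomial at a pushed-forward law is the sum of the eight-world monomials over the
fibres. -/
lemma mono_pushfP (p q r : Fin 5) (μ : Fin 8 → ℚ) :
    mono p q r (pushfP π μ) = ∑ i : Fin 8, ∑ j : Fin 8, ∑ k : Fin 8,
      if π i = p ∧ π j = q ∧ π k = r then mono8 i j k μ else 0 := by
  simp only [mono, mono8, pushfP]
  rw [Finset.sum_mul_sum, Finset.sum_mul]
  refine Finset.sum_congr rfl fun i _ => ?_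
  rw [Finset.sum_mul]
  refine Finset.sum_congr rfl fun j _ => ?_
  rw [Finset.mul_sum]
  refine Finset.sum_congr rfl fun k _ => ?_
  split_ifs <;> simp_all

/-- A five-world Harris generator at a pushed-forward law is the sum of the eight-world generators over
the fibre of its partition. -/
lemma hgen_pushfP (p : Fin 5) (s : Fin 9) (μ : Fin 8 → ℚ) :
    hgen p s (pushfP π μ) = ∑ a : Fin 8, if π a = p then genP π a s μ else 0 := by
  simp only [hgen, genP]
  conv_lhs => rw [show pushfP π μ p = ∑ a : Fin 8, if π a = p then μ a else 0 from rfl]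
  rw [Finset.sum_mul]
  refine Finset.sum_congr rfl fun a _ => ?_
  split_ifs <;> simp

/-- A triple sum over `Fin 5` of a fibre indicator of `(π i, π j, π k)` collapses. -/
lemma sum_fibre3P (i j k : Fin 8) (f : Fin 5 → Fin 5 → Fin 5 → ℚ) :
    (∑ p : Fin 5, ∑ q : Fin 5, ∑ r : Fin 5, if π i = p ∧ π j = q ∧ π k = r then f p q r else 0) =
      f (π i) (π j) (π k) := by
  rw [Fintype.sum_eq_single (π i) (fun p hp => Finset.sum_eq_zero fun q _ => Finset.sum_eq_zero fun r _ =>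
    by simp [Ne.symm hp])]
  rw [Fintype.sum_eq_single (π j) (fun q hq => Finset.sum_eq_zero fun r _ => by simp [Ne.symm hq])]
  rw [Fintype.sum_eq_single (π k) (fun r hr => by simp [Ne.symm hr])]
  simp

/-- Commuting three outer sums past three inner sums (product-type route). -/
lemma sum33_comm {A B C I J K : Type*} [Fintype A] [Fintype B] [Fintype C] [Fintype I] [Fintype J]
    [Fintype K] (f : A → B → C → I → J → K → ℚ) :
    (∑ a, ∑ b, ∑ c, ∑ i, ∑ j, ∑ k, f a b c i j k) = ∑ i, ∑ j, ∑ k, ∑ a, ∑ b, ∑ c, f a b c i j k :=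
  calc (∑ a, ∑ b, ∑ c, ∑ i, ∑ j, ∑ k, f a b c i j k)
      = ∑ u : A × B × C, ∑ y : I × J × K, f u.1 u.2.1 u.2.2 y.1 y.2.1 y.2.2 := by
        simp only [Fintype.sum_prod_type]
    _ = ∑ y : I × J × K, ∑ u : A × B × C, f u.1 u.2.1 u.2.2 y.1 y.2.1 y.2.2 := Finset.sum_comm
    _ = ∑ i, ∑ j, ∑ k, ∑ a, ∑ b, ∑ c, f a b c i j k := by
        simp only [Fintype.sum_prod_type]

/-- The monomial part of a five-world combination, pulled back. -/
lemma sum_mono_pushfP (lm : Fin 5 → Fin 5 → Fin 5 → ℚ) (μ : Fin 8 → ℚ) :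
    (∑ p : Fin 5, ∑ q : Fin 5, ∑ r : Fin 5, lm p q r * mono p q r (pushfP π μ)) =
      ∑ i : Fin 8, ∑ j : Fin 8, ∑ k : Fin 8, lm (π i) (π j) (π k) * mono8 i j k μ := by
  simp only [mono_pushfP, Finset.mul_sum]
  rw [sum33_comm]
  refine Finset.sum_congr rfl fun i _ => Finset.sum_congr rfl fun j _ => Finset.sum_congr rfl fun k _ => ?_
  rw [← sum_fibre3P π i j k (fun p q r => lm p q r * mono8 i j k μ)]
  refine Finset.sum_congr rfl fun p _ => Finset.sum_congr rfl fun q _ => Finset.sum_congr rfl fun r _ => ?_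
  split_ifs <;> simp

/-- The generator part of a five-world combination, pulled back. -/
lemma sum_hgen_pushfP (lh : Fin 5 → Fin 9 → ℚ) (μ : Fin 8 → ℚ) :
    (∑ p : Fin 5, ∑ s : Fin 9, lh p s * hgen p s (pushfP π μ)) =
      ∑ a : Fin 8, ∑ s : Fin 9, lh (π a) s * genP π a s μ := by
  simp only [hgen_pushfP, Finset.mul_sum]
  have step : ∀ a : Fin 8, ∀ s : Fin 9,
      (∑ p : Fin 5, lh p s * (if π a = p then genP π a s μ else 0)) = lh (π a) s * genP π a s μ := by
    intro a s
    rw [← sum_fibreP π a (fun p => lh p s * genP π a s μ)]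
    refine Finset.sum_congr rfl fun p _ => ?_
    split_ifs <;> simp
  calc (∑ p : Fin 5, ∑ s : Fin 9, ∑ a : Fin 8, lh p s * (if π a = p then genP π a s μ else 0))
      = ∑ s : Fin 9, ∑ a : Fin 8, ∑ p : Fin 5, lh p s * (if π a = p then genP π a s μ else 0) :=
        Finset.sum_comm.trans (Finset.sum_congr rfl fun s _ => Finset.sum_comm)
    _ = ∑ s : Fin 9, ∑ a : Fin 8, lh (π a) s * genP π a s μ :=
        Finset.sum_congr rfl fun s _ => Finset.sum_congr rfl fun a _ => step a s
    _ = ∑ a : Fin 8, ∑ s : Fin 9, lh (π a) s * genP π a s μ := Finset.sum_comm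

/-- **The five-world cone pulls back to the eight-world cone**: a cubic in `ThreeTerm.InCone`, composed
with the push-forward along `π`, lies in `InConeP π`. -/
theorem inConeP_of_inCone {N : (Fin 5 → ℚ) → ℚ} (h : InCone N) :
    InConeP π (fun μ => N (pushfP π μ)) := by
  obtain ⟨lm, lh, hm, hh, heq⟩ := h
  refine ⟨fun i j k => lm (π i) (π j) (π k), fun a s => lh (π a) s, fun i j k => hm _ _ _,
    fun a s => hh _ _, fun μ => ?_⟩
  show N (pushfP π μ) = (∑ i, ∑ j, ∑ k, lm (π i) (π j) (π k) * mono8 i j k μ) +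
    ∑ a, ∑ s, lh (π a) s * genP π a s μ
  rw [heq (pushfP π μ), sum_mono_pushfP, sum_hgen_pushfP]

/-- A coefficient array constant on the fibres of `π` gives the pulled-back five-world cubic. -/
lemma cubicOf_eq_pushfP (T₅ : Fin 5 → Fin 5 → Fin 5 → ℚ) :
    cubicOf (fun i j k => T₅ (π i) (π j) (π k)) =
      fun μ => (∑ p : Fin 5, ∑ q : Fin 5, ∑ r : Fin 5, T₅ p q r * mono p q r (pushfP π μ)) := by
  funext μ
  rw [sum_mono_pushfP]
  rfl

/-- **A certificate on the partition table certifies the pattern table**: if the five-world cubic of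
`T₅` is in the Harris cone and `T` is its pull-back along `π`, then `cubicOf T` is in `InConeP π`. -/
theorem inConeP_cubicOf_of_inCone (T₅ : Fin 5 → Fin 5 → Fin 5 → ℚ) (T : Fin 8 → Fin 8 → Fin 8 → ℚ)
    (hT : ∀ i j k, T i j k = T₅ (π i) (π j) (π k))
    (h : InCone (fun ν => ∑ p : Fin 5, ∑ q : Fin 5, ∑ r : Fin 5, T₅ p q r * mono p q r ν)) :
    InConeP π (cubicOf T) := by
  have hTf : T = fun i j k => T₅ (π i) (π j) (π k) := by
    funext i j k; exact hT i j k
  rw [hTf, cubicOf_eq_pushfP]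
  exact inConeP_of_inCone π h

end Transfer

end Part

end Summit.Ventures.PercRepro2
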